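import Mathlib.MeasureTheory.Integral.IntegralEqImproper
import Mathlib.Probability.Kernel.Composition.IntegralCompProd
import Mathlib.Probability.Kernel.Composition.MeasureComp
import Literature.MathematicalPhysics.KineticTheory.InfiniteChainGibbsMomentaIndependence
import Literature.MathematicalPhysics.KineticTheory.InfiniteChainSpecificationLocality
import HarnessLib

/-!
# Integration by parts in one site of a DLR state: the one-site Gibbs kernel on position observables

Topic `Literature/MathematicalPhysics/KineticTheory` (companion of `InfiniteChainDynamics` — `chainSpecification`, LLL (14) —,
`InfiniteChainGibbsMomentaIndependence`, `InfiniteChainSpecificationLocality`). The measure-theoretic ingredients of the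
classical equipartition / Schwinger–Dyson identities `T·E_μ[∂_{q_x} g] = E_μ[g·∂_{q_x}H]` for DLR states `μ` of an
oscillator chain (`InfiniteChainGibbsBondForceByParts` carries them out for the pinned anharmonic chain):

* §1 real line: `T ∫ g' e^{-h/T} = ∫ g h' e^{-h/T}` for differentiable `g`, `h` with the three products integrable
  (Mathlib `integral_eq_zero_of_hasDerivAt_of_integrable`); Gaussian domination of `|x|ⁿ` and of polynomially bounded
  continuous functions against a weight `≤ e^{-a x²}`;
* §2 for a chain `P` with continuous `U`, `V`, `T > 0`: the one-site kernel `γ_{i}(· | η)` on a measurable observable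
  reading only the inserted POSITION is the ratio `(∫ φ e^{-h_η/T} dq) / (∫ e^{-h_η/T} dq)`,
  `h_η(q) = U(q) + V(q_{i+1} − q) + V(q − q_{i−1})` (the momentum Gaussian and the normaliser factor out; Fubini);
* §3 the DLR equation for INTEGRABLE real observables, `∫ Φ dμ = ∫ (∫ Φ dγ_Λ(·|η)) dμ(η)`, under LLL's condition B2
  (Georgii 2011, Remark 1.24, `μ γ_Λ = μ`, as the composition of `μ` with the Markov kernel `γ_Λ`; Mathlib
  `Kernel.integral_comp`) — the `ℝ≥0∞` form is the tree's `lintegral_lintegral_eq_of_dlr`;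
* §4 an elementary polynomial-growth toolkit (`|u + βu³|`, `|1 + 3βu²|`, `|ω₂q + lam q³|` against `(1 + |q|)ⁿ`).

Everything is proved; tagged `[folklore]` / `[cite: …]`. No definitions, no named facts. NOT here: any identity for a
specific chain (see `InfiniteChainGibbsBondForceByParts`), momentum observables (see `InfiniteChainGibbsMomentaIndependence`).
-/

noncomputable section

open MeasureTheory ProbabilityTheory Filter Set Real Literature.Probability.LatticeModels
open scoped ENNReal Topology

namespace Literature.MathematicalPhysics.KineticTheory.HeatConduction

open OscillatorChain

/-! ## §1 One-dimensional integration by parts against `e^{-h/T}` -/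

/-- **Integration by parts against a Boltzmann weight on `ℝ`.** If `g`, `h` are differentiable with
derivatives `g'`, `h'`, `T ≠ 0`, and `g e^{-h/T}`, `g' e^{-h/T}`, `g h' e^{-h/T}` are Lebesgue integrable, then
`T ∫ g' e^{-h/T} = ∫ g h' e^{-h/T}` (the derivative of the integrable function `g e^{-h/T}` integrates to `0`).
[folklore] -/
theorem integral_deriv_mul_exp_eq {T : ℝ} (hT : T ≠ 0) {g g' h h' : ℝ → ℝ}
    (hg : ∀ x, HasDerivAt g (g' x) x) (hh : ∀ x, HasDerivAt h (h' x) x)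
    (hi₀ : Integrable fun x => g x * exp (-h x / T))
    (hi₁ : Integrable fun x => g' x * exp (-h x / T))
    (hi₂ : Integrable fun x => g x * h' x * exp (-h x / T)) :
    T * ∫ x, g' x * exp (-h x / T) = ∫ x, g x * h' x * exp (-h x / T) := by
  have hderiv : ∀ x, HasDerivAt (fun x => g x * exp (-h x / T))
      (g' x * exp (-h x / T) + -T⁻¹ * (g x * h' x * exp (-h x / T))) x := by
    intro x
    have he : HasDerivAt (fun x => exp (-h x / T)) (exp (-h x / T) * (-h' x / T)) x := by
      have h1 : HasDerivAt (fun x => -h x / T) (-h' x / T) x := (hh x).neg.div_const T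
      exact h1.exp
    refine ((hg x).mul he).congr_deriv ?_
    field_simp
  have hint : Integrable fun x => g' x * exp (-h x / T) + -T⁻¹ * (g x * h' x * exp (-h x / T)) :=
    hi₁.add (hi₂.const_mul _)
  have h0 := integral_eq_zero_of_hasDerivAt_of_integrable hderiv hint hi₀
  rw [integral_add hi₁ (hi₂.const_mul _), integral_const_mul] at h0
  have : ∫ x, g' x * exp (-h x / T) = T⁻¹ * ∫ x, g x * h' x * exp (-h x / T) := by linarith
  rw [this, ← mul_assoc, mul_inv_cancel₀ hT, one_mul]

/-- **Gaussian domination of monomials**: for `a > 0` and `n : ℕ`, `x ↦ |x| ^ n * exp (-(a * x ^ 2))` is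
Lebesgue integrable on `ℝ` (`|x|^n ≤ 1 + x^{2n}` and `((a/2)x²)^n ≤ n! e^{(a/2)x²}`). [folklore] -/
theorem integrable_abs_pow_mul_exp_neg_mul_sq {a : ℝ} (ha : 0 < a) (n : ℕ) :
    Integrable fun x : ℝ => |x| ^ n * exp (-(a * x ^ 2)) := by
  have hgauss : Integrable fun x : ℝ => exp (-(a / 2) * x ^ 2) := integrable_exp_neg_mul_sq (by positivity)
  have hdom : Integrable fun x : ℝ => (1 + (n.factorial : ℝ) / (a / 2) ^ n) * exp (-(a / 2) * x ^ 2) :=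
    hgauss.const_mul _
  refine hdom.mono' (by fun_prop) (Eventually.of_forall fun x => ?_)
  rw [Real.norm_eq_abs, abs_of_nonneg (by positivity)]
  have ha2 : 0 < a / 2 := by positivity
  -- `((a/2) x²)^n ≤ n! e^{(a/2) x²}` hence `(x²)^n e^{-(a/2)x²} ≤ n!/(a/2)^n`; and `|x|^n ≤ 1 + (x²)^n`.
  have hpow : ((a / 2) * x ^ 2) ^ n ≤ (n.factorial : ℝ) * exp ((a / 2) * x ^ 2) := by
    have hf : (0:ℝ) < n.factorial := by exact_mod_cast n.factorial_pos
    have h := (div_le_iff₀ hf).1 (Real.pow_div_factorial_le_exp ((a / 2) * x ^ 2) (by positivity) n)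
    linarith
  have hx2n : (x ^ 2) ^ n * exp (-(a / 2) * x ^ 2) ≤ (n.factorial : ℝ) / (a / 2) ^ n := by
    rw [mul_pow] at hpow
    rw [le_div_iff₀ (pow_pos ha2 n)]
    have hee : exp ((a / 2) * x ^ 2) * exp (-(a / 2) * x ^ 2) = 1 := by
      rw [← Real.exp_add]; simp
    calc (x ^ 2) ^ n * exp (-(a / 2) * x ^ 2) * (a / 2) ^ n
        = ((a / 2) ^ n * (x ^ 2) ^ n) * exp (-(a / 2) * x ^ 2) := by ring
      _ ≤ ((n.factorial : ℝ) * exp ((a / 2) * x ^ 2)) * exp (-(a / 2) * x ^ 2) :=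
          mul_le_mul_of_nonneg_right hpow (exp_pos _).le
      _ = (n.factorial : ℝ) := by rw [mul_assoc, hee, mul_one]
  have habs : |x| ^ n ≤ 1 + (x ^ 2) ^ n := by
    rw [← sq_abs]
    rcases le_or_gt (|x|) 1 with h1 | h1
    · calc |x| ^ n ≤ 1 := pow_le_one₀ (abs_nonneg x) h1
        _ ≤ 1 + (|x| ^ 2) ^ n := le_add_of_nonneg_right (by positivity)
    · calc |x| ^ n ≤ (|x| ^ 2) ^ n := by
            rw [← pow_mul]
            exact pow_le_pow_right₀ h1.le (by omega)
        _ ≤ 1 + (|x| ^ 2) ^ n := le_add_of_nonneg_left zero_le_one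
  have hexp : exp (-(a * x ^ 2)) = exp (-(a / 2) * x ^ 2) * exp (-(a / 2) * x ^ 2) := by
    rw [← Real.exp_add]; congr 1; ring
  have hE : 0 < exp (-(a / 2) * x ^ 2) := exp_pos _
  have hE1 : exp (-(a / 2) * x ^ 2) ≤ 1 := by
    rw [exp_le_one_iff]; nlinarith [sq_nonneg x]
  rw [hexp, ← mul_assoc]
  refine mul_le_mul_of_nonneg_right ?_ hE.le
  calc |x| ^ n * exp (-(a / 2) * x ^ 2) ≤ (1 + (x ^ 2) ^ n) * exp (-(a / 2) * x ^ 2) :=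
        mul_le_mul_of_nonneg_right habs hE.le
    _ = exp (-(a / 2) * x ^ 2) + (x ^ 2) ^ n * exp (-(a / 2) * x ^ 2) := by ring
    _ ≤ 1 + (n.factorial : ℝ) / (a / 2) ^ n := add_le_add hE1 hx2n

/-- **Polynomially bounded continuous functions against a super-Gaussian weight are integrable**: if `F` is
continuous, `|F x| ≤ C (1 + |x|) ^ n` and `w` is continuous with `0 ≤ w x ≤ exp (-(a x²))`, `a > 0`, then
`F · w ∈ L¹(ℝ)`. [folklore] -/
theorem integrable_mul_of_abs_le_pow_of_le_gauss {F w : ℝ → ℝ} (hF : Continuous F) (hw : Continuous w)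
    {C a : ℝ} {n : ℕ} (ha : 0 < a) (hFb : ∀ x, |F x| ≤ C * (1 + |x|) ^ n)
    (hw0 : ∀ x, 0 ≤ w x) (hwb : ∀ x, w x ≤ exp (-(a * x ^ 2))) :
    Integrable fun x => F x * w x := by
  -- `(1+|x|)^n ≤ 2^n (1 + |x|^n)` and both `e^{-a x²}` and `|x|^n e^{-a x²}` are integrable
  have h1 : Integrable fun x : ℝ => exp (-(a * x ^ 2)) := by
    have := integrable_exp_neg_mul_sq ha
    exact this.congr (Eventually.of_forall fun x => by simp [neg_mul])
  have h2 := integrable_abs_pow_mul_exp_neg_mul_sq ha n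
  have hdom : Integrable fun x : ℝ => |C| * 2 ^ n * (exp (-(a * x ^ 2)) + |x| ^ n * exp (-(a * x ^ 2))) :=
    (h1.add h2).const_mul _
  refine hdom.mono' (hF.mul hw).aestronglyMeasurable (Eventually.of_forall fun x => ?_)
  rw [Real.norm_eq_abs, abs_mul, abs_of_nonneg (hw0 x)]
  have hx : 0 ≤ |x| := abs_nonneg x
  have h2n : (0:ℝ) < 2 ^ n := by positivity
  have hxn : (0:ℝ) ≤ |x| ^ n := by positivity
  have hpow : (1 + |x|) ^ n ≤ 2 ^ n * (1 + |x| ^ n) := by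
    rcases le_or_gt (|x|) 1 with h | h
    · calc (1 + |x|) ^ n ≤ (2:ℝ) ^ n := by
            apply pow_le_pow_left₀ (by positivity); linarith
        _ ≤ 2 ^ n * (1 + |x| ^ n) := by nlinarith
    · calc (1 + |x|) ^ n ≤ (2 * |x|) ^ n := by
            apply pow_le_pow_left₀ (by positivity); linarith
        _ = 2 ^ n * |x| ^ n := by rw [mul_pow]
        _ ≤ 2 ^ n * (1 + |x| ^ n) := by nlinarith
  have hC : C * (1 + |x|) ^ n ≤ |C| * (2 ^ n * (1 + |x| ^ n)) :=
    calc C * (1 + |x|) ^ n ≤ |C| * (1 + |x|) ^ n :=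
          mul_le_mul_of_nonneg_right (le_abs_self C) (by positivity)
      _ ≤ |C| * (2 ^ n * (1 + |x| ^ n)) := mul_le_mul_of_nonneg_left hpow (abs_nonneg C)
  calc |F x| * w x ≤ C * (1 + |x|) ^ n * w x := mul_le_mul_of_nonneg_right (hFb x) (hw0 x)
    _ ≤ |C| * (2 ^ n * (1 + |x| ^ n)) * exp (-(a * x ^ 2)) :=
        mul_le_mul hC (hwb x) (hw0 x) (by positivity)
    _ = |C| * 2 ^ n * (exp (-(a * x ^ 2)) + |x| ^ n * exp (-(a * x ^ 2))) := by ring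

/-! ## §2 The one-site Gibbs kernel on position observables -/

/-- The momentum Gaussian has positive total mass: `∫ e^{-p²/(2T)} dp = √(2πT) > 0`. [folklore] -/
theorem integral_exp_neg_sq_div_pos {T : ℝ} (hT : 0 < T) : 0 < ∫ p : ℝ, exp (-p ^ 2 / (2 * T)) := by
  have e : (fun p : ℝ => exp (-p ^ 2 / (2 * T))) = fun p => exp (-(1 / (2 * T)) * p ^ 2) := by
    funext p; congr 1; field_simp
  rw [e, integral_gaussian]
  exact Real.sqrt_pos.2 (by positivity)

/-- **The one-site Gibbs kernel on a position observable.** For a chain with continuous `U`, `V`, `T > 0`,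
a site `i`, a boundary condition `η` and a measurable observable `Φ` which, along the configurations
`siteInsert i η (q, p)`, reads only the inserted POSITION (`Φ(siteInsert i η (q,p)) = φ(q)`):
`∫ Φ dγ_{i}(· | η) = (∫ φ(q) e^{-h_η(q)/T} dq) / (∫ e^{-h_η(q)/T} dq)`,
`h_η(q) = U(q) + V(q_{i+1} − q) + V(q − q_{i−1})` — the momentum Gaussian `e^{-p²/(2T)}` and the normaliser
factor out (LLL (14) in the volume `{i}`; Fubini on `dq dp`). [cite: LanfordLebowitzLieb1977, §4 eq. (14)] -/
theorem integral_chainSpecification_singleton_position {P : OscillatorChain} (hU : Continuous P.U)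
    (hV : Continuous P.V) {T : ℝ} (hT : 0 < T) (i : ℤ) (η : ChainConfig) {Φ : ChainConfig → ℝ}
    (hΦ : Measurable Φ) {φ : ℝ → ℝ} (hΦφ : ∀ z : ℝ × ℝ, Φ (siteInsert i η z) = φ z.1) :
    ∫ σ, Φ σ ∂(P.chainSpecification T {i} η) =
      (∫ q, φ q * exp (-(P.U q + (P.V ((η (i + 1)).1 - q) + P.V (q - (η (i - 1)).1))) / T)) /
        ∫ q, exp (-(P.U q + (P.V ((η (i + 1)).1 - q) + P.V (q - (η (i - 1)).1))) / T) := by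
  classical
  -- notation (as in `lintegral_snd_mul_chainSpecification_singleton`)
  set f : ChainConfig → ℝ := fun σ => -T⁻¹ * hamiltonianIn P.chainPotential chainSupp {i} σ with hf
  have hfm : Measurable f :=
    measurable_const.mul (P.continuous_hamiltonianIn_chain_singleton hU hV i).measurable
  set W : ℝ → ℝ := fun q => P.U q + (P.V ((η (i + 1)).1 - q) + P.V (q - (η (i - 1)).1)) with hW
  have hWm : Measurable W := by
    have : Continuous W := by simp only [hW]; fun_prop
    exact this.measurable
  have hfins : ∀ z : ℝ × ℝ, exp (f (siteInsert i η z)) = exp (-(W z.1) / T) * exp (-z.2 ^ 2 / (2 * T)) := by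
    intro z
    have hi1 : i + 1 ≠ i := by omega
    have hi2 : i - 1 ≠ i := by omega
    rw [← Real.exp_add]
    congr 1
    simp only [hf, hamiltonianIn_chain_singleton, siteInsert_apply_self,
      siteInsert_apply_of_ne hi1, siteInsert_apply_of_ne hi2, hW]
    field_simp
    ring
  set ν₁ : Measure ChainConfig := (Measure.pi fun _ : ({i} : Finset ℤ) =>
    (volume : Measure (ℝ × ℝ))).map (fun ζ => glueWith {i} ζ η) with hν₁
  have hν₁siteInsert : ν₁ = (volume : Measure (ℝ × ℝ)).map (siteInsert i η) :=
    map_glueWith_singleton i η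
  set Z : ℝ := ∫ σ, exp (f σ) ∂ν₁ with hZ
  have hγt : P.chainSpecification T {i} η = ν₁.tilted f := rfl
  -- reduction of `γ`-integrals of real observables to Lebesgue integrals over the inserted site
  have red : ∀ F : ChainConfig → ℝ, Measurable F →
      ∫ σ, F σ ∂(P.chainSpecification T {i} η) =
        Z⁻¹ * ∫ z : ℝ × ℝ, (exp (-(W z.1) / T) * F (siteInsert i η z)) * exp (-z.2 ^ 2 / (2 * T)) := by
    intro F hF
    have hF' : Measurable fun σ : ChainConfig => (exp (f σ) / Z) * F σ :=
      ((measurable_exp.comp hfm).div_const Z).mul hF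
    rw [hγt, integral_tilted]
    simp_rw [smul_eq_mul]
    rw [← hZ, hν₁siteInsert, integral_map (measurable_siteInsert i η).aemeasurable hF'.aestronglyMeasurable,
      ← integral_const_mul]
    refine integral_congr_ae (Eventually.of_forall fun z => ?_)
    simp only []
    rw [hfins, div_eq_mul_inv]
    ring
  have hS := integral_exp_neg_sq_div_pos hT
  set S : ℝ := ∫ p : ℝ, exp (-p ^ 2 / (2 * T)) with hSdef
  -- numerator
  have h1 : ∫ σ, Φ σ ∂(P.chainSpecification T {i} η) = Z⁻¹ * ((∫ q, φ q * exp (-(W q) / T)) * S) := by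
    rw [red Φ hΦ]
    congr 1
    have e : ∀ z : ℝ × ℝ, (exp (-(W z.1) / T) * Φ (siteInsert i η z)) * exp (-z.2 ^ 2 / (2 * T)) =
        (φ z.1 * exp (-(W z.1) / T)) * exp (-z.2 ^ 2 / (2 * T)) := by
      intro z; rw [hΦφ]; ring
    simp_rw [e]
    rw [Measure.volume_eq_prod]
    exact integral_prod_mul (fun q : ℝ => φ q * exp (-(W q) / T)) (fun p : ℝ => exp (-p ^ 2 / (2 * T)))
  -- normaliser
  have h2 : Z = (∫ q, exp (-(W q) / T)) * S := by
    rw [hZ, hν₁siteInsert,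
      integral_map (measurable_siteInsert i η).aemeasurable hfm.exp.aestronglyMeasurable]
    simp_rw [hfins]
    rw [Measure.volume_eq_prod]
    exact integral_prod_mul (fun q : ℝ => exp (-(W q) / T)) (fun p : ℝ => exp (-p ^ 2 / (2 * T)))
  rw [h1, h2, mul_inv, show ∀ a b c d : ℝ, a * b * (c * d) = (b * d) * (a * c) from fun a b c d => by ring,
    inv_mul_cancel₀ hS.ne', one_mul, inv_mul_eq_div]

/-! ## §3 The DLR equation for integrable observables -/

/-- **DLR equation for integrable real observables.** If all finite-volume Gibbs distributions of the chain are
probability measures (LLL B2) and `μ` is a DLR state, then for every finite `Λ` and every `Φ ∈ L¹(μ)`: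
`∫ Φ dμ = ∫ (∫ Φ dγ_Λ(· | η)) dμ(η)` (Georgii 2011, Remark 1.24: `μ γ_Λ = μ`, as a composition of `μ` with the
Markov kernel `γ_Λ`; Mathlib `Kernel.integral_comp`). [cite: Georgii2011, Rem. 1.24] -/
theorem integral_eq_integral_integral_chainSpecification {P : OscillatorChain} (hU : Measurable P.U)
    (hV : Measurable P.V) {T : ℝ} (hB2 : P.CondB2 T) {μ : Measure ChainConfig}
    (hμ : P.IsChainGibbsMeasure T μ) (Λ : Finset ℤ) {Φ : ChainConfig → ℝ} (hΦ : Integrable Φ μ) :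
    ∫ σ, Φ σ ∂μ = ∫ η, ∫ σ, Φ σ ∂(P.chainSpecification T Λ η) ∂μ := by
  have hmeas : ∀ A : Set ChainConfig, MeasurableSet A →
      Measurable fun η => P.chainSpecification T Λ η A := fun A hA =>
    P.measurable_chainSpecification_apply hU hV T Λ hA
  let κ : Kernel ChainConfig ChainConfig :=
    ⟨fun η => P.chainSpecification T Λ η, Measure.measurable_of_measurable_coe _ hmeas⟩
  have hMK : IsMarkovKernel κ := ⟨fun η => hB2 Λ η⟩
  have hbind : μ.bind κ = μ := by
    ext A hA
    rw [Measure.bind_apply hA (Kernel.aemeasurable κ)]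
    exact hμ.2 Λ A hA
  have hΦ' : Integrable Φ (μ.bind κ) := by rwa [hbind]
  calc ∫ σ, Φ σ ∂μ = ∫ σ, Φ σ ∂(μ.bind κ) := by rw [hbind]
    _ = ∫ η, ∫ σ, Φ σ ∂(κ η) ∂μ := by
        change Integrable Φ (κ ∘ₘ μ) at hΦ'
        rw [Measure.comp_eq_comp_const_apply] at hΦ' ⊢
        rw [Kernel.integral_comp hΦ', Kernel.const_apply]
    _ = ∫ η, ∫ σ, Φ σ ∂(P.chainSpecification T Λ η) ∂μ := rfl

/-! ## §4 Pointwise polynomial-growth toolkit -/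

/-- `|u + βu³| ≤ (c + βc³) t³` when `|u| ≤ c t`, `t ≥ 1`, `β, c ≥ 0`. [folklore] -/
theorem abs_add_mul_cube_le {β c u t : ℝ} (hβ : 0 ≤ β) (hc : 0 ≤ c) (hu : |u| ≤ c * t) (ht : 1 ≤ t) :
    |u + β * u ^ 3| ≤ (c + β * c ^ 3) * t ^ 3 := by
  have hu0 : 0 ≤ |u| := abs_nonneg u
  have hct : 0 ≤ c * t := hu0.trans hu
  have h3 : |u| ^ 3 ≤ (c * t) ^ 3 := pow_le_pow_left₀ hu0 hu 3
  have ht3 : t ≤ t ^ 3 := by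
    calc t = t ^ 1 := (pow_one t).symm
      _ ≤ t ^ 3 := pow_le_pow_right₀ ht (by norm_num)
  calc |u + β * u ^ 3| ≤ |u| + |β * u ^ 3| := abs_add_le _ _
    _ = |u| + β * |u| ^ 3 := by rw [abs_mul, abs_of_nonneg hβ, abs_pow]
    _ ≤ c * t ^ 3 + β * (c * t) ^ 3 := by
        gcongr
        calc |u| ≤ c * t := hu
          _ ≤ c * t ^ 3 := mul_le_mul_of_nonneg_left ht3 hc
    _ = (c + β * c ^ 3) * t ^ 3 := by ring

/-- `|1 + 3βu²| ≤ (1 + 3βc²) t²` when `|u| ≤ c t`, `t ≥ 1`, `β, c ≥ 0`. [folklore] -/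
theorem abs_one_add_mul_sq_le {β c u t : ℝ} (hβ : 0 ≤ β) (hu : |u| ≤ c * t) (ht : 1 ≤ t) :
    |1 + 3 * β * u ^ 2| ≤ (1 + 3 * β * c ^ 2) * t ^ 2 := by
  have hu0 : 0 ≤ |u| := abs_nonneg u
  have h2 : u ^ 2 ≤ (c * t) ^ 2 := by
    rw [← sq_abs]; exact pow_le_pow_left₀ hu0 hu 2
  have ht2 : 1 ≤ t ^ 2 := one_le_pow₀ ht
  have hnn : 0 ≤ 1 + 3 * β * u ^ 2 := by positivity
  rw [abs_of_nonneg hnn]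
  nlinarith [mul_nonneg hβ (sq_nonneg c)]

/-- `|ω₂ q + lam q³| ≤ (ω₂ c + lam c³) t³` when `|q| ≤ c t`, `t ≥ 1`, `ω₂, lam, c ≥ 0`. [folklore] -/
theorem abs_lin_add_cube_le {ω₂ lam c q t : ℝ} (hω : 0 ≤ ω₂) (hl : 0 ≤ lam) (hc : 0 ≤ c)
    (hq : |q| ≤ c * t) (ht : 1 ≤ t) :
    |ω₂ * q + lam * q ^ 3| ≤ (ω₂ * c + lam * c ^ 3) * t ^ 3 := by
  have hq0 : 0 ≤ |q| := abs_nonneg q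
  have h3 : |q| ^ 3 ≤ (c * t) ^ 3 := pow_le_pow_left₀ hq0 hq 3
  have ht3 : t ≤ t ^ 3 := by
    calc t = t ^ 1 := (pow_one t).symm
      _ ≤ t ^ 3 := pow_le_pow_right₀ ht (by norm_num)
  calc |ω₂ * q + lam * q ^ 3| ≤ |ω₂ * q| + |lam * q ^ 3| := abs_add_le _ _
    _ = ω₂ * |q| + lam * |q| ^ 3 := by rw [abs_mul, abs_mul, abs_of_nonneg hω, abs_of_nonneg hl, abs_pow]
    _ ≤ ω₂ * (c * t ^ 3) + lam * (c * t) ^ 3 := by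
        gcongr
        calc |q| ≤ c * t := hq
          _ ≤ c * t ^ 3 := mul_le_mul_of_nonneg_left ht3 hc
    _ = (ω₂ * c + lam * c ^ 3) * t ^ 3 := by ring

/-- `|q − a| ≤ (1 + |a| + |b|)(1 + |q|)`, `|b − q| ≤ (1 + |a| + |b|)(1 + |q|)` and `|q| ≤ (1 + |a| + |b|)(1 + |q|)`.
[folklore] -/
theorem abs_shift_le (a b q : ℝ) :
    |q - a| ≤ (1 + |a| + |b|) * (1 + |q|) ∧ |b - q| ≤ (1 + |a| + |b|) * (1 + |q|) ∧
      |q| ≤ (1 + |a| + |b|) * (1 + |q|) := by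
  have ha := abs_nonneg a; have hb := abs_nonneg b; have hq := abs_nonneg q
  have h1 : |q - a| ≤ |q| + |a| := abs_sub q a
  have h2 : |b - q| ≤ |b| + |q| := abs_sub b q
  refine ⟨?_, ?_, ?_⟩ <;> nlinarith [mul_nonneg ha hq, mul_nonneg hb hq]

end Literature.MathematicalPhysics.KineticTheory.HeatConduction

end
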